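import Literature.RingTheory.CohomologyAnnihilator.StableAnnihilation
import HarnessLib

/-!
# Stable annihilation along a syzygy: the two directions

Helper for the crux `NoZenoR` (stmt-ResolutionOfSingularities-19943), W4.4 toric arenas
(lead g15, KERNEL-g15 §2B, Proposition 15.5). For a short exact sequence
`S : 0 → X₁ —f→ X₂ —g→ X₃ → 0` in an `R`-linear abelian category (think `X₂` projective, so that
`X₁ = Ω X₃` is a syzygy of `X₃`) and a scalar `c : R`:

* **down the syzygy, for free** (`exists_comp_eq_smul_id_X₁_of_comp_eq_smul_id_X₃`): if the
  homothety `c • 𝟙 X₃` lifts along `g` (`ψ ≫ g = c • 𝟙 X₃` for some `ψ : X₃ ⟶ X₂`), then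
  `c • 𝟙 X₁` extends over `f` (`f ≫ τ = c • 𝟙 X₁` for some `τ : X₂ ⟶ X₁`). With `X₂` projective:
  `c` stably zero on `X₃` ⟹ `c` stably zero on `Ω X₃` — the monotonicity `sann(X) ⊆ sann(Ω X)`.
* **up the syzygy, with an obstruction** (`exists_comp_eq_smul_id_X₃_of_comp_eq_smul_id_X₁`):
  if `c • 𝟙 X₁ = ι ≫ π` factors through an object `P` AND the map `ι : X₁ ⟶ P` extends over `f`
  — which is automatic when `Ext¹(X₃, P) = 0`
  (`exists_comp_eq_smul_id_X₃_of_comp_eq_smul_id_X₁_of_ext_eq_zero`) — then `c • 𝟙 X₃` lifts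
  along `g`. With `X₂` and `P` projective this is the statement
  **`Ext¹(X, P) = 0` for projectives `P` ⟹ `sann(Ω X) = sann(X)`**
  (`exists_projective_comp_eq_smul_id_X₃`), i.e. the stable annihilator does not grow along the
  syzygy of a module with no `Ext¹` into projectives. Over a Gorenstein ring every maximal
  Cohen–Macaulay module is such; over the non-Gorenstein cyclic quotient threefolds of the W4.4
  census it singles out the modules on which the cohomology-annihilator exclusions persist from
  level `d + 1` to level `d + 2` (KERNEL-g15 Theorem 15.7).

Proof of the second direction: extend `ι` to `ι' : X₂ ⟶ P`; the endomorphism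
`N := c • 𝟙 X₂ - ι' ≫ π ≫ f` of `X₂` kills `f`, hence descends to `ν : X₃ ⟶ X₂` with `g ≫ ν = N`,
and `g ≫ ν ≫ g = N ≫ g = c • g` gives `ν ≫ g = c • 𝟙 X₃` because `g` is an epimorphism.

These statements are folklore homological algebra written for this work (candidate helper; not a
statement of any manuscript).

## References

* S. B. Iyengar, R. Takahashi, *Annihilation of cohomology and strong generation of module
  categories*, IMRN 2016; arXiv:1404.1476 — §2 (Remark 2.13) for the surrounding formalism.
  [`IyengarTakahashi2014`]
-/

noncomputable section

open CategoryTheory CategoryTheory.Abelian CategoryTheory.Limits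
open Literature.RingTheory.CohomologyAnnihilator

universe w t v u

-- single-problem summit: the doubled namespace component `ResolutionOfSingularities` is forced by the layout
set_option linter.dupNamespace false

namespace Summit.ResolutionOfSingularities.ResolutionOfSingularities.Theorems.NoZeno.SyzygyStability

variable {R : Type t} [Ring R] {C : Type u} [Category.{v} C] [Abelian C] [Linear R C]
  [HasExt.{w} C]

omit [HasExt.{w} C] in
/-- **Down the syzygy.** Let `S : 0 → X₁ —f→ X₂ —g→ X₃ → 0` be short exact. If the homothety
`c • 𝟙 X₃` lifts along `g` (`ψ ≫ g = c • 𝟙 X₃`), then `c • 𝟙 X₁` extends over `f`: there is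
`τ : X₂ ⟶ X₁` with `f ≫ τ = c • 𝟙 X₁`. Indeed `c • 𝟙 X₂ - g ≫ ψ` is killed by `g` on the right,
so it factors as `τ ≫ f` through the kernel `f`, and `f ≫ τ ≫ f = c • f` with `f` mono.
(With `X₂` projective: `c` stably zero on `X₃` implies `c` stably zero on the syzygy `X₁`.)
[folklore] -/
theorem exists_comp_eq_smul_id_X₁_of_comp_eq_smul_id_X₃ {S : ShortComplex C} (hS : S.ShortExact)
    {c : R} (ψ : S.X₃ ⟶ S.X₂) (hψ : ψ ≫ S.g = c • 𝟙 S.X₃) :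
    ∃ τ : S.X₂ ⟶ S.X₁, S.f ≫ τ = c • 𝟙 S.X₁ := by
  have := hS.mono_f
  have hk : (c • 𝟙 S.X₂ - S.g ≫ ψ) ≫ S.g = 0 := by
    rw [Preadditive.sub_comp, Category.assoc, hψ, Linear.smul_comp, Linear.comp_smul,
      Category.id_comp, Category.comp_id, sub_self]
  refine ⟨hS.exact.lift (c • 𝟙 S.X₂ - S.g ≫ ψ) hk, ?_⟩
  rw [← cancel_mono S.f, Category.assoc, hS.exact.lift_f, Preadditive.comp_sub,
    ← Category.assoc, S.zero, zero_comp, sub_zero, Linear.comp_smul, Linear.smul_comp,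
    Category.comp_id, Category.id_comp]

/-- **Up the syzygy, with the obstruction made explicit.** Let `S : 0 → X₁ —f→ X₂ —g→ X₃ → 0` be
short exact and suppose the homothety `c • 𝟙 X₁` factors as `X₁ —ι→ P —π→ X₁` through some object
`P`, where `ι` extends over `f`, i.e. the obstruction `hS.extClass ∘ ι ∈ Ext¹(X₃, P)` vanishes.
Then `c • 𝟙 X₃` lifts along `g`: there is `ν : X₃ ⟶ X₂` with `ν ≫ g = c • 𝟙 X₃`.
Proof: with `f ≫ ι' = ι`, the endomorphism `N = c • 𝟙 X₂ - ι' ≫ π ≫ f` satisfies `f ≫ N = 0`,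
so `N = g ≫ ν`; then `g ≫ ν ≫ g = N ≫ g = c • g` and `g` is epi. [this work; folklore] -/
theorem exists_comp_eq_smul_id_X₃_of_comp_eq_smul_id_X₁ {S : ShortComplex C} (hS : S.ShortExact)
    {c : R} {P : C} (ι : S.X₁ ⟶ P) (π : P ⟶ S.X₁) (hιπ : ι ≫ π = c • 𝟙 S.X₁)
    (hext : hS.extClass.comp (Ext.mk₀ ι) (add_zero 1) = 0) :
    ∃ ν : S.X₃ ⟶ S.X₂, ν ≫ S.g = c • 𝟙 S.X₃ := by
  have := hS.epi_g
  obtain ⟨y, hy⟩ := Ext.contravariant_sequence_exact₁ hS P (Ext.mk₀ ι) (add_zero 1) hext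
  obtain ⟨ι', rfl⟩ := (Ext.mk₀_bijective _ _).2 y
  have hf : S.f ≫ ι' = ι := (Ext.mk₀_bijective _ _).1 (by rw [← Ext.mk₀_comp_mk₀]; exact hy)
  have hN : S.f ≫ (c • 𝟙 S.X₂ - ι' ≫ π ≫ S.f) = 0 := by
    rw [Preadditive.comp_sub, ← Category.assoc, hf, ← Category.assoc, hιπ, Linear.comp_smul,
      Linear.smul_comp, Category.comp_id, Category.id_comp, sub_self]
  refine ⟨hS.exact.desc (c • 𝟙 S.X₂ - ι' ≫ π ≫ S.f) hN, ?_⟩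
  rw [← cancel_epi S.g, ← Category.assoc, hS.exact.g_desc, Preadditive.sub_comp, Category.assoc,
    Category.assoc, S.zero, comp_zero, comp_zero, sub_zero, Linear.smul_comp, Linear.comp_smul,
    Category.id_comp, Category.comp_id]

/-- **Up the syzygy when `Ext¹(X₃, P) = 0`.** If `c • 𝟙 X₁` factors through an object `P` with
`Ext¹(X₃, P) = 0`, then `c • 𝟙 X₃` lifts along `g : X₂ ⟶ X₃`. [this work; folklore] -/
theorem exists_comp_eq_smul_id_X₃_of_comp_eq_smul_id_X₁_of_ext_eq_zero {S : ShortComplex C}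
    (hS : S.ShortExact) {c : R} {P : C} (ι : S.X₁ ⟶ P) (π : P ⟶ S.X₁)
    (hιπ : ι ≫ π = c • 𝟙 S.X₁) (hP : ∀ e : Ext S.X₃ P 1, e = 0) :
    ∃ ν : S.X₃ ⟶ S.X₂, ν ≫ S.g = c • 𝟙 S.X₃ :=
  exists_comp_eq_smul_id_X₃_of_comp_eq_smul_id_X₁ hS ι π hιπ (hP _)

/-- **`sann(Ω X) ⊆ sann(X)` when `X` has no `Ext¹` into the relevant projective.** Let
`S : 0 → X₁ → X₂ → X₃ → 0` be short exact with `X₂` projective (`X₁` is a syzygy of `X₃`). If `c` is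
stably zero on `X₁` — `c • 𝟙 X₁` factors through a projective object `P` — and `Ext¹(X₃, P) = 0`,
then `c` is stably zero on `X₃`: `c • 𝟙 X₃` factors through the projective `X₂`. Together with
`exists_comp_eq_smul_id_X₁_of_comp_eq_smul_id_X₃` this says that the stable annihilator is
CONSTANT along the syzygy of a module without `Ext¹` into projectives (e.g. every maximal
Cohen–Macaulay module over a Gorenstein local ring; over a non-Gorenstein ring this is a genuine
condition — KERNEL-g15 Prop. 15.5, Thm. 15.7). [this work] -/
theorem exists_projective_comp_eq_smul_id_X₃ {S : ShortComplex C} (hS : S.ShortExact)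
    [Projective S.X₂] {c : R}
    (h₁ : ∃ (P : C) (_ : Projective P) (ι : S.X₁ ⟶ P) (π : P ⟶ S.X₁),
      ι ≫ π = c • 𝟙 S.X₁ ∧ ∀ e : Ext S.X₃ P 1, e = 0) :
    ∃ (Q : C) (_ : Projective Q) (i : S.X₃ ⟶ Q) (p : Q ⟶ S.X₃), i ≫ p = c • 𝟙 S.X₃ := by
  obtain ⟨P, _, ι, π, hιπ, hP⟩ := h₁
  obtain ⟨ν, hν⟩ := exists_comp_eq_smul_id_X₃_of_comp_eq_smul_id_X₁_of_ext_eq_zero hS ι π hιπ hP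
  exact ⟨S.X₂, inferInstance, ν, S.g, hν⟩

omit [HasExt.{w} C] in
/-- **`sann(X) ⊆ sann(Ω X)`**, projective-object form: if `X₂` is projective and `c • 𝟙 X₃` factors
through SOME projective object, then it lifts along `g` and `c • 𝟙 X₁` factors through the
projective `X₂`. [folklore] -/
theorem exists_projective_comp_eq_smul_id_X₁ {S : ShortComplex C} (hS : S.ShortExact)
    [Projective S.X₂] {c : R}
    (h₃ : ∃ (Q : C) (_ : Projective Q) (i : S.X₃ ⟶ Q) (p : Q ⟶ S.X₃), i ≫ p = c • 𝟙 S.X₃) :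
    ∃ (P : C) (_ : Projective P) (ι : S.X₁ ⟶ P) (π : P ⟶ S.X₁), ι ≫ π = c • 𝟙 S.X₁ := by
  obtain ⟨Q, hQ, i, p, hip⟩ := h₃
  have := hS.epi_g
  -- lift `p : Q ⟶ X₃` along the epimorphism `g`
  obtain ⟨p', hp'⟩ : ∃ p' : Q ⟶ S.X₂, p' ≫ S.g = p := ⟨Projective.factorThru p S.g, by simp⟩
  obtain ⟨τ, hτ⟩ := exists_comp_eq_smul_id_X₁_of_comp_eq_smul_id_X₃ hS (i ≫ p')
    (by rw [Category.assoc, hp', hip])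
  exact ⟨S.X₂, inferInstance, S.f, τ, hτ⟩

/-- **Annihilator form, up the syzygy.** In the situation of
`exists_comp_eq_smul_id_X₃_of_comp_eq_smul_id_X₁_of_ext_eq_zero` with `X₂` projective, `c` kills
`Extⁱ(X₃, N)` for every object `N` and every `i ≥ 1`. [this work] -/
theorem smul_ext_X₃_eq_zero_of_comp_eq_smul_id_X₁ {S : ShortComplex C} (hS : S.ShortExact)
    [Projective S.X₂] {c : R} {P : C} (ι : S.X₁ ⟶ P) (π : P ⟶ S.X₁)
    (hιπ : ι ≫ π = c • 𝟙 S.X₁) (hP : ∀ e : Ext S.X₃ P 1, e = 0) {N : C} {i : ℕ} (hi : 1 ≤ i)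
    (e : Ext S.X₃ N i) : c • e = 0 := by
  obtain ⟨ν, hν⟩ := exists_comp_eq_smul_id_X₃_of_comp_eq_smul_id_X₁_of_ext_eq_zero hS ι π hιπ hP
  exact smul_ext_eq_zero_of_comp_eq_smul_id ν S.g hν hi e


/-- **Up the syzygy at the price of an annihilator of the obstruction** (KERNEL-g15 Prop. 15.5′).
Let `S : 0 → X₁ —f→ X₂ —g→ X₃ → 0` be short exact, let `b • 𝟙 X₁ = ι ≫ π` factor through an object
`P`, and let the scalar `a` kill the obstruction `hS.extClass ∘ ι ∈ Ext¹(X₃, P)` (for instance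
`a ∈ ann Ext¹(X₃, P)`; over a Cohen–Macaulay local ring with canonical module `ω` and `P` free,
every `a ∈ tr(ω)` does this for every maximal Cohen–Macaulay `X₃` [Dao–Kobayashi–Takahashi]).
Then `(a * b) • 𝟙 X₃` lifts along `g`: `a • ι` extends over `f` and `(a • ι) ≫ π = (a * b) • 𝟙 X₁`.
So `ann Ext¹(X, P) · sann(Ω X) ⊆ sann(X)` for the part of `sann(Ω X)` realised through `P`.
[this work] -/
theorem exists_comp_eq_mul_smul_id_X₃_of_smul_obstruction_eq_zero {S : ShortComplex C}
    (hS : S.ShortExact) {a b : R} {P : C} (ι : S.X₁ ⟶ P) (π : P ⟶ S.X₁)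
    (hιπ : ι ≫ π = b • 𝟙 S.X₁) (ha : a • hS.extClass.comp (Ext.mk₀ ι) (add_zero 1) = 0) :
    ∃ ν : S.X₃ ⟶ S.X₂, ν ≫ S.g = (a * b) • 𝟙 S.X₃ := by
  refine exists_comp_eq_smul_id_X₃_of_comp_eq_smul_id_X₁ hS (a • ι) π ?_ ?_
  · rw [Linear.smul_comp, hιπ, smul_smul]
  · rw [Ext.mk₀_smul, Ext.comp_smul, ha]

/-- **Annihilator form of Prop. 15.5′.** With `X₂` projective: if `b` is stably zero on the
syzygy `X₁` through `P` and `a` kills `Ext¹(X₃, P)`, then `a * b` kills `Extⁱ(X₃, N)` for all `N`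
and all `i ≥ 1`. [this work] -/
theorem mul_smul_ext_X₃_eq_zero_of_comp_eq_smul_id_X₁ {S : ShortComplex C} (hS : S.ShortExact)
    [Projective S.X₂] {a b : R} {P : C} (ι : S.X₁ ⟶ P) (π : P ⟶ S.X₁)
    (hιπ : ι ≫ π = b • 𝟙 S.X₁) (hP : ∀ e : Ext S.X₃ P 1, a • e = 0) {N : C} {i : ℕ} (hi : 1 ≤ i)
    (e : Ext S.X₃ N i) : (a * b) • e = 0 := by
  obtain ⟨ν, hν⟩ := exists_comp_eq_mul_smul_id_X₃_of_smul_obstruction_eq_zero hS ι π hιπ (hP _)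
  exact smul_ext_eq_zero_of_comp_eq_smul_id ν S.g hν hi e


/-! ## Module categories: free modules of finite rank and the hypothesis `Ext¹(X, A) = 0` -/

section ModuleCat

variable {A : Type u} [CommRing A]

/-- `Ext` into a finite product is controlled factorwise: if `a` kills `Extⁿ(X, N j)` for every `j`
then `a` kills `Extⁿ(X, Π j, N j)` (`𝟙 = Σⱼ πⱼ ≫ ιⱼ` and bilinearity of composition; second-variable
companion of `SplitCoverFloor.ext_smul_eq_zero_of_piFamily`). [folklore] -/
theorem smul_ext_eq_zero_of_piFamily_snd {ι : Type} [Fintype ι] [DecidableEq ι]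
    (N : ι → ModuleCat.{u} A) {X : ModuleCat.{u} A} {n : ℕ} (a : A)
    (h : ∀ (j : ι) (e : Ext.{u} X (N j) n), a • e = 0)
    (e : Ext.{u} X (ModuleCat.of A (Π j, N j)) n) : a • e = 0 := by
  let π : ∀ j : ι, (ModuleCat.of A (Π j, N j) ⟶ N j) := fun j => ModuleCat.ofHom (LinearMap.proj j)
  let ι' : ∀ j : ι, (N j ⟶ ModuleCat.of A (Π j, N j)) :=
    fun j => ModuleCat.ofHom (LinearMap.single A (fun j => (N j : Type u)) j)
  have hid : ∑ j, π j ≫ ι' j = 𝟙 (ModuleCat.of A (Π j, N j)) := by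
    apply ModuleCat.hom_ext
    refine LinearMap.ext fun v => ?_
    simp only [ModuleCat.hom_sum, ModuleCat.hom_comp, LinearMap.coe_sum, Finset.sum_apply,
      LinearMap.coe_comp, Function.comp_apply, ModuleCat.hom_id, LinearMap.id_coe, id_eq]
    conv_rhs => rw [← Finset.univ_sum_single v]
    simp [π, ι']
  have he : e = ∑ j, (e.comp (Ext.mk₀ (π j)) (add_zero n)).comp (Ext.mk₀ (ι' j)) (add_zero n) := by
    simp only [Ext.comp_assoc_of_second_deg_zero, Ext.mk₀_comp_mk₀]
    rw [← Ext.comp_sum, ← Ext.mk₀_sum, hid, Ext.comp_mk₀_id]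
  rw [he, Finset.smul_sum]
  exact Finset.sum_eq_zero fun j _ => by rw [← Ext.smul_comp, h j, Ext.zero_comp]

/-- `Extⁿ(X, N j) = 0` for all `j` ⟹ `Extⁿ(X, Π j, N j) = 0`. [folklore] -/
theorem ext_eq_zero_of_piFamily_snd {ι : Type} [Fintype ι] [DecidableEq ι]
    (N : ι → ModuleCat.{u} A) {X : ModuleCat.{u} A} {n : ℕ}
    (h : ∀ (j : ι) (e : Ext.{u} X (N j) n), e = 0)
    (e : Ext.{u} X (ModuleCat.of A (Π j, N j)) n) : e = 0 := by
  simpa using smul_ext_eq_zero_of_piFamily_snd N (1 : A) (fun j e' => by rw [h j e', smul_zero]) e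

/-- **`Ext¹(X, A) = 0` ⟹ the stable annihilator does not grow along the syzygy** (module form of
KERNEL-g15 Prop. 15.5). Let `S : 0 → X₁ → X₂ → X₃ → 0` be short exact in `ModuleCat A` and suppose
the homothety `c • 𝟙 X₁` factors through a free module `Aᶥ` of finite rank. If `Ext¹_A(X₃, A) = 0`
then `c • 𝟙 X₃` lifts along `S.g`; in particular, when `X₂` is projective (`X₁ = Ω X₃`), `c` is
stably zero on `X₃`. Over a Cohen–Macaulay ring that is regular on the punctured spectrum this
applies to every maximal Cohen–Macaulay `X₃` whose `A`-dual is again maximal Cohen–Macaulay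
(KERNEL-g15 Thm. 15.7: the Koszul modules `N_[j]` with `(S/𝔞)_{Σδ−j+nk} = 0`). [this work] -/
theorem exists_comp_eq_smul_id_X₃_of_free {S : ShortComplex (ModuleCat.{u} A)} (hS : S.ShortExact)
    {c : A} {ι : Type} [Fintype ι] [DecidableEq ι]
    (i : S.X₁ ⟶ ModuleCat.of A (ι → A)) (p : ModuleCat.of A (ι → A) ⟶ S.X₁)
    (hip : i ≫ p = c • 𝟙 S.X₁) (hA : ∀ e : Ext.{u} S.X₃ (ModuleCat.of A A) 1, e = 0) :
    ∃ ν : S.X₃ ⟶ S.X₂, ν ≫ S.g = c • 𝟙 S.X₃ :=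
  exists_comp_eq_smul_id_X₃_of_comp_eq_smul_id_X₁_of_ext_eq_zero hS i p hip
    (ext_eq_zero_of_piFamily_snd (fun _ : ι => ModuleCat.of A A) (fun _ e => hA e))

/-- **`ann Ext¹(X, A) · sann(Ω X) ⊆ sann(X)`, free-module form** (KERNEL-g15 Prop. 15.5′; with
[Dao–Kobayashi–Takahashi: `tr ω = ann Ext¹(CM, A)`] it gives `tr(ω) · sann(Ω X) ⊆ sann(X)` over a
Cohen–Macaulay local ring with canonical module `ω`): if `b • 𝟙 X₁` factors through `Aᶥ` and `a`
kills `Ext¹_A(X₃, A)`, then `(a * b) • 𝟙 X₃` lifts along `S.g`. [this work] -/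
theorem exists_comp_eq_mul_smul_id_X₃_of_free {S : ShortComplex (ModuleCat.{u} A)}
    (hS : S.ShortExact) {a b : A} {ι : Type} [Fintype ι] [DecidableEq ι]
    (i : S.X₁ ⟶ ModuleCat.of A (ι → A)) (p : ModuleCat.of A (ι → A) ⟶ S.X₁)
    (hip : i ≫ p = b • 𝟙 S.X₁) (hA : ∀ e : Ext.{u} S.X₃ (ModuleCat.of A A) 1, a • e = 0) :
    ∃ ν : S.X₃ ⟶ S.X₂, ν ≫ S.g = (a * b) • 𝟙 S.X₃ :=
  exists_comp_eq_mul_smul_id_X₃_of_smul_obstruction_eq_zero hS i p hip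
    (smul_ext_eq_zero_of_piFamily_snd (fun _ : ι => ModuleCat.of A A) a (fun _ e => hA e) _)

end ModuleCat

end Summit.ResolutionOfSingularities.ResolutionOfSingularities.Theorems.NoZeno.SyzygyStability
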